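import Summits.CriticalPhenomena.PercolationContinuityZ3.Theorems.PercNearOneGluingNoHeavyLowerTailCubicThreePointGluing
import HarnessLib

/-!
# Gluing two pieces along a 2-separator `{u, v}`: connections in the glued graph

Support file for crux `stmt-CriticalPhenomena-4575` (four-point decreasing `E₃` frontier: the 2-separation programme for row 44,
memo `run/shared/lean/prim/prim-l12/FROM-prim-l12-p6-g15-ROW44-CUT-VERTICES.md` §3), seat `prim-l12-p6` gen 15.  No definitions,
no named facts, no sorries.  Pure graph theory, the two-vertex analogue of `TerminalGluing.cutVertex_iff`.

Two pieces `G₁, G₂` on one vertex type share only the vertices `u, v` (every vertex with neighbours in both pieces is `u` or `v`).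
* `TerminalGluing.twoSep_cross_iff`: for `x` without `G₂`-edges and `z` without `G₁`-edges (unless they are `u` or `v`), `x ≠ z`:
  `x ↔ z` in `G₁ ⊔ G₂` iff `x ↔ s` in `G₁` and `s ↔ z` in `G₂` for some `s ∈ {u, v}`;
* `TerminalGluing.twoSep_same_iff`: for `x, x'` without `G₂`-edges (unless `u`/`v`): `x ↔ x'` in `G₁ ⊔ G₂` iff `x ↔ x'` in `G₁`, or
  `x ↔ s` in `G₁`, `s ↔ t` in `G₂`, `t ↔ x'` in `G₁` with `{s, t} ⊆ {u, v}` (a detour through the other piece).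
Both follow from the terminal-chain decomposition `reachable_sup_decomp` with `T = {u, v}`: along a chain of terminals a
`G₁`-prefix from `x` can always be maintained because the chain only ever visits two vertices.
-/

namespace Summit.CriticalPhenomena.PercolationContinuityZ3.Theorems

namespace TerminalGluing

open SimpleGraph

variable {V : Type*} {G₁ G₂ : SimpleGraph V} {u v : V}

/-- Two members of `{u, v}` different from a third member of `{u, v}` are equal. [folklore] -/
theorem eq_of_mem_pair_of_ne {s b c : V} (hs : s = u ∨ s = v) (hb : b = u ∨ b = v) (hc : c = u ∨ c = v)
    (hsb : s ≠ b) (hcb : c ≠ b) : s = c := by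
  rcases hs with rfl | rfl <;> rcases hb with rfl | rfl <;> rcases hc with rfl | rfl <;>
    first | rfl | exact absurd rfl hsb | exact absurd rfl hcb

/-- Along a terminal chain inside `{u,v}` the invariant "`x ↔ t` in `G₁`, or `x ↔ s` in `G₁` and `s ↔ t` in `G₂` for some
`s ∈ {u,v}`" propagates from the start to the end of the chain. [folklore] -/
theorem twoSep_chain_invariant {x z z' : V}
    (hchain : Relation.ReflTransGen
      (fun p q => p ∈ ({w | w = u ∨ w = v} : Set V) ∧ q ∈ ({w | w = u ∨ w = v} : Set V) ∧ (G₁.Reachable p q ∨ G₂.Reachable p q))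
      z z')
    (hz : z = u ∨ z = v)
    (hstart : G₁.Reachable x z ∨ ∃ s, (s = u ∨ s = v) ∧ G₁.Reachable x s ∧ G₂.Reachable s z) :
    (z' = u ∨ z' = v) ∧ (G₁.Reachable x z' ∨ ∃ s, (s = u ∨ s = v) ∧ G₁.Reachable x s ∧ G₂.Reachable s z') := by
  induction hchain with
  | refl => exact ⟨hz, hstart⟩
  | @tail b c _ hstep ih =>
    obtain ⟨hbT, hI⟩ := ih
    obtain ⟨_, hcT, hbc⟩ := hstep
    have hcT' : c = u ∨ c = v := hcT
    refine ⟨hcT', ?_⟩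
    rcases hI with h1 | ⟨s, hsT, hxs, hsb⟩
    · rcases hbc with hbc | hbc
      · exact Or.inl (h1.trans hbc)
      · exact Or.inr ⟨b, hbT, h1, hbc⟩
    · rcases hbc with hbc | hbc
      · -- `x ~₁ s ~₂ b ~₁ c` with `s, b, c ∈ {u,v}`
        by_cases hcb : c = b
        · subst hcb; exact Or.inr ⟨s, hsT, hxs, hsb⟩
        · by_cases hsb' : s = b
          · subst hsb'; exact Or.inl (hxs.trans hbc)
          · have hsc : s = c := eq_of_mem_pair_of_ne hsT hbT hcT' hsb' hcb
            subst hsc; exact Or.inl hxs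
      · exact Or.inr ⟨s, hsT, hxs, hsb.trans hbc⟩

/-- **Across a 2-separator.**  Pieces sharing only `u, v`; `x` has no `G₂`-edges and `z` no `G₁`-edges unless they belong to
`{u,v}`; `x ≠ z`.  Then `x ↔ z` in `G₁ ⊔ G₂` iff `x ↔ s` in `G₁` and `s ↔ z` in `G₂` for some `s ∈ {u,v}`. [folklore] -/
theorem twoSep_cross_iff (hT : ∀ w y y', G₁.Adj w y → G₂.Adj w y' → (w = u ∨ w = v)) {x z : V}
    (hx : ¬ (x = u ∨ x = v) → ∀ y, ¬ G₂.Adj x y) (hz : ¬ (z = u ∨ z = v) → ∀ y, ¬ G₁.Adj z y) (hxz : x ≠ z) :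
    (G₁ ⊔ G₂).Reachable x z ↔ ∃ s, (s = u ∨ s = v) ∧ G₁.Reachable x s ∧ G₂.Reachable s z := by
  have hT' : ∀ w y y', G₁.Adj w y → G₂.Adj w y' → w ∈ ({w | w = u ∨ w = v} : Set V) := hT
  constructor
  · intro hr
    -- `x ↔ y` inside piece 2 forces `x = y` or `x ∈ {u,v}`
    have side2 : ∀ {y}, G₂.Reachable x y → x = y ∨ (x = u ∨ x = v) := fun h2 => by
      by_cases hxT : x = u ∨ x = v
      · exact Or.inr hxT
      · exact Or.inl (eq_of_reachable_of_isolated (hx hxT) h2)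
    -- from the invariant at a terminal `t` and a piece-2 connection `t ↔ z`, conclude
    have finish : ∀ {t}, (t = u ∨ t = v) →
        (G₁.Reachable x t ∨ ∃ s, (s = u ∨ s = v) ∧ G₁.Reachable x s ∧ G₂.Reachable s t) → G₂.Reachable t z →
        ∃ s, (s = u ∨ s = v) ∧ G₁.Reachable x s ∧ G₂.Reachable s z := by
      intro t htT hI htz
      rcases hI with h1 | ⟨s, hsT, hxs, hst⟩
      · exact ⟨t, htT, h1, htz⟩
      · exact ⟨s, hsT, hxs, hst.trans htz⟩
    rcases reachable_sup_decomp hT' hr with (h1 | h2) | ⟨z₀, z₁, hz₀, _, hxz₀, hch, hz₁z⟩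
    · -- `x ↔ z` in piece 1: `z` must be a terminal (else isolated in piece 1 and equal to `x`)
      by_cases hzT : z = u ∨ z = v
      · exact ⟨z, hzT, h1, Reachable.refl _⟩
      · exact absurd (eq_of_reachable_of_isolated (hz hzT) h1.symm).symm hxz
    · rcases side2 h2 with e | hxT
      · exact absurd e hxz
      · exact ⟨x, hxT, Reachable.refl _, h2⟩
    · have hz₀' : z₀ = u ∨ z₀ = v := hz₀
      have hstart : G₁.Reachable x z₀ ∨ ∃ s, (s = u ∨ s = v) ∧ G₁.Reachable x s ∧ G₂.Reachable s z₀ := by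
        rcases hxz₀ with h1 | h2
        · exact Or.inl h1
        · rcases side2 h2 with e | hxT
          · subst e; exact Or.inl (Reachable.refl _)
          · exact Or.inr ⟨x, hxT, Reachable.refl _, h2⟩
      by_cases hzT : z = u ∨ z = v
      · -- extend the chain by the last segment `z₁ ↔ z` (both terminals)
        obtain ⟨hz₁T, _⟩ := twoSep_chain_invariant hch hz₀' hstart
        have hch' := Relation.ReflTransGen.tail hch ⟨(hz₁T : z₁ ∈ ({w | w = u ∨ w = v} : Set V)), (hzT : z ∈ _), hz₁z⟩
        obtain ⟨_, hI⟩ := twoSep_chain_invariant hch' hz₀' hstart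
        exact finish hzT hI (Reachable.refl _)
      · obtain ⟨hz₁T, hI⟩ := twoSep_chain_invariant hch hz₀' hstart
        rcases hz₁z with h1 | h2
        · -- `z` is isolated in piece 1, so `z = z₁`
          have e : z = z₁ := eq_of_reachable_of_isolated (hz hzT) h1.symm
          subst e
          exact finish hz₁T hI (Reachable.refl _)
        · exact finish hz₁T hI h2
  · rintro ⟨s, _, h1, h2⟩
    exact (reachable_sup_of_side (Or.inl h1)).trans (reachable_sup_of_side (Or.inr h2))

/-- **Same side of a 2-separator.**  Pieces sharing only `u, v`; `x, x'` have no `G₂`-edges unless they belong to `{u,v}`.  Then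
`x ↔ x'` in `G₁ ⊔ G₂` iff `x ↔ x'` in `G₁`, or `x ↔ s` in `G₁`, `s ↔ t` in `G₂`, `t ↔ x'` in `G₁` for some `s, t ∈ {u,v}`
(a detour through piece 2). [folklore] -/
theorem twoSep_same_iff (hT : ∀ w y y', G₁.Adj w y → G₂.Adj w y' → (w = u ∨ w = v)) {x x' : V}
    (hx : ¬ (x = u ∨ x = v) → ∀ y, ¬ G₂.Adj x y) (hx' : ¬ (x' = u ∨ x' = v) → ∀ y, ¬ G₂.Adj x' y) :
    (G₁ ⊔ G₂).Reachable x x' ↔ G₁.Reachable x x' ∨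
      ∃ s t, (s = u ∨ s = v) ∧ (t = u ∨ t = v) ∧ G₁.Reachable x s ∧ G₂.Reachable s t ∧ G₁.Reachable t x' := by
  have hT' : ∀ w y y', G₁.Adj w y → G₂.Adj w y' → w ∈ ({w | w = u ∨ w = v} : Set V) := hT
  constructor
  · intro hr
    have side2 : ∀ {p y : V}, (¬ (p = u ∨ p = v) → ∀ y, ¬ G₂.Adj p y) → G₂.Reachable p y → p = y ∨ (p = u ∨ p = v) :=
      fun {p y} hp h2 => by
        by_cases hpT : p = u ∨ p = v
        · exact Or.inr hpT
        · exact Or.inl (eq_of_reachable_of_isolated (hp hpT) h2)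
    have finish : ∀ {t}, (t = u ∨ t = v) →
        (G₁.Reachable x t ∨ ∃ s, (s = u ∨ s = v) ∧ G₁.Reachable x s ∧ G₂.Reachable s t) → G₁.Reachable t x' →
        G₁.Reachable x x' ∨
          ∃ s t, (s = u ∨ s = v) ∧ (t = u ∨ t = v) ∧ G₁.Reachable x s ∧ G₂.Reachable s t ∧ G₁.Reachable t x' := by
      intro t htT hI htx
      rcases hI with h1 | ⟨s, hsT, hxs, hst⟩
      · exact Or.inl (h1.trans htx)
      · exact Or.inr ⟨s, t, hsT, htT, hxs, hst, htx⟩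
    rcases reachable_sup_decomp hT' hr with (h1 | h2) | ⟨z₀, z₁, hz₀, _, hxz₀, hch, hz₁z⟩
    · exact Or.inl h1
    · rcases side2 hx h2 with e | hxT
      · subst e; exact Or.inl (Reachable.refl _)
      · -- `x` is a terminal joined to `x'` in piece 2: then `x'` is `x` or a terminal
        rcases side2 hx' h2.symm with e | hx'T
        · subst e; exact Or.inl (Reachable.refl _)
        · exact Or.inr ⟨x, x', hxT, hx'T, Reachable.refl _, h2, Reachable.refl _⟩
    · have hz₀' : z₀ = u ∨ z₀ = v := hz₀
      have hstart : G₁.Reachable x z₀ ∨ ∃ s, (s = u ∨ s = v) ∧ G₁.Reachable x s ∧ G₂.Reachable s z₀ := by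
        rcases hxz₀ with h1 | h2
        · exact Or.inl h1
        · rcases side2 hx h2 with e | hxT
          · subst e; exact Or.inl (Reachable.refl _)
          · exact Or.inr ⟨x, hxT, Reachable.refl _, h2⟩
      obtain ⟨hz₁T, hI⟩ := twoSep_chain_invariant hch hz₀' hstart
      rcases hz₁z with h1 | h2
      · exact finish hz₁T hI h1
      · -- last segment in piece 2: `x'` is `z₁` or a terminal; extend the chain
        rcases side2 hx' h2.symm with e | hx'T
        · subst e; exact finish hz₁T hI (Reachable.refl _)
        · have hch' := Relation.ReflTransGen.tail hch
            ⟨(hz₁T : z₁ ∈ ({w | w = u ∨ w = v} : Set V)), (hx'T : x' ∈ _), Or.inr h2⟩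
          obtain ⟨_, hI'⟩ := twoSep_chain_invariant hch' hz₀' hstart
          exact finish hx'T hI' (Reachable.refl _)
  · rintro (h1 | ⟨s, t, _, _, h1, h2, h3⟩)
    · exact reachable_sup_of_side (Or.inl h1)
    · exact ((reachable_sup_of_side (Or.inl h1)).trans (reachable_sup_of_side (Or.inr h2))).trans
        (reachable_sup_of_side (Or.inl h3))

end TerminalGluing

end Summit.CriticalPhenomena.PercolationContinuityZ3.Theorems
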